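import Mathlib
import Summits.QuantumFields.BalabanUV.Beta.EriceRemainderEnclosureHistoryAutonomyComparisonAgeCompositionDecaySlotCertificate

/-!
# EriceRemainderEnclosureHistoryAutonomyComparisonAgeCompositionDecayBoundaryOldCertificate — (E85b) route (N), first order: THE SCALAR CERTIFICATE FOR THE
# OLD CHAIN OF THE FIRST SLOT MERGED WITH THE BOUNDARY of the (S-d) budget — the slot's old credit `3c_{p+1}ρ_p` plus the old part of the old decay step's
# credit against `c_{m+1}`, the lag-zero and defect∕tail parts and the extra window damping `c_{m+2}`, by interval splitting on the inner rise

Cell `pub-balaban`, β-function sub-cell, BINDER row D4 «RemainderConst leaves for Bałaban's split» (`HOME/BINDER-OWNERS.md`; owner lineage `b2b-balaban-beta-an4`;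
this file by co-owner #2 lineage `b2b-balaban-beta-d4-p2`, generation 76), β-FLOW TEAM duty (1), FREEZE (0) honoured (def-free; imports (E85a)
`…DecaySlotCertificate` (`old_core`, `cap_of_inner`) and Mathlib; pure real-variable inequalities, no flow object).  Part of successor item (E84d-2).

HONEST FRAMING (page 1, verbatim and binding).  *"Discharging BetaPertH makes Bałaban's UV stability UNCONDITIONAL — a real constructive-QFT result; it is
NOT the continuum limit and NOT the Clay problem."*  THIS FILE DISCHARGES NOTHING OF THE KIND.  Elementary real algebra in the census letters of route (N)
(`t = h_{p+k}∕h_{p+k+1}`, `l = h_{p+k−1}∕h_{p+k}`, `R = (h_{p+1}∕h_{p+k})²`, `w = h_{p+1}∕h_{p+2}`, `v = h_p∕h_{p+1}`, `g = h_{p+k}∕h_{p+2}`, `x = k·L_kh_{p+k}³∕2`,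
`σ = 1 − (h_{p+k}∕h_p)²`, `q = h_{p+2k}∕h_{p+k}`, `q' = h_{p+2k−1}∕h_{p+k+1}`); nothing here depends on a flow.  The form, signs, ages and moments of Bałaban's
(1.22) limit functional are NOT PRINTED ([I] p. 298; GAPS G-t4-U2-1∕-2) and NOT asserted.  Row D4 class UNCHANGED (critical-path width 0; instance 0∕1; D4
DISCHARGE NO DATE).  HONEST DEPENDENCY: continuum YM on T⁴ ⇐ BetaPertH ∧ nine spine estimates (0/9 proved); BetaPertH ⇐ (D1) ∧ (D4) ∧ CAP+tail; G-an2-4 gates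
asym, D1 and NE2/3/4.

THE POINT (census sense (α); route (N); README `HOME/b2b-balaban-beta-d4-p2/g76/e85/README.md`).  The slot of the first pin `p = m+2` is MERGED with the
boundary of (E84c) `budget_of_slots`: it pays `F_{m+1} + c_p∕(1−c_p) + ϑ_pω_p + F_{m+2} + DE` out of `A_{m+2} + A_{m+k} + Σ_{q≥m+3} S_q`, `S_q = (4∕3)d_{q+1}`.  Per unit
`c₁ = c_{p+1}` its OLD CHAIN is **`MO = 3Rt² + 3l²q't² − l³t³ − t³∕(1−x∕k) − k(t²−1)(3t+t³)∕(2(1−x)) − t³`** (§1 `merged_old_cert`, `k ≥ 3`: five intervals of `R`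
through (E85a) `old_core` with the extra credit coefficient `3l²q' ≥ 3∕√(1+σ)` from the old read of the old decay step and the extra debit `c_{m+2} = t³c₁`;
`merged_old_two`, `k = 2`: the old decay step IS the slot's step, credit `6l²t²`, one interval).  NUMERICS OF RECORD (`g76/numerics/chains.py`, `prooff.py`,
`corners2.py`, `gen_so.py`): `MO ≥ 0.26` (`k ≥ 3`), `≥ 2.9` (`k = 2`); corner constants generated and verified in exact rational arithmetic.  NOT CLAIMED: anything
along a flow (next files); anything printed.

WHAT IS PROVED ([folklore]; 0 `def`, 0 sorry).  §1 `merged_old_case`, **`merged_old_cert`**, **`merged_old_two`**.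
-/
noncomputable section

namespace Summit.QuantumFields.BalabanUV.Beta.EriceRemainderEnclosureHistoryAutonomyComparisonAgeCompositionDecayBoundaryOldCertificate

open Summit.QuantumFields.BalabanUV.Beta.EriceRemainderEnclosureHistoryAutonomyComparisonAgeCompositionDecaySlotCertificate (old_core cap_of_inner)

/-! ## §1 The old chain of the merged first slot -/

/-- One interval of the inner rise for the merged old chain, `k ≥ 3` (as (E85a) `old_slot_case` with `y_p ≤ 1∕3`, the extra credit coefficient
`3l²q' ≥ 3∕sh` and the extra debit `t³`). [folklore] -/
theorem merged_old_case {R t l x k σ q q' Rlo Rhi S sh X T2 T l2m lh L acr : ℝ}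
    (hk : 3 ≤ k) (hR1 : 1 ≤ R) (ht1 : 1 ≤ t) (hl1 : 1 ≤ l) (htl : t ≤ l) (hly : l ^ 2 ≤ 4 / 3) (hlR : l ^ 2 ≤ R)
    (hlσ : (k - 1) * (l ^ 2 - 1) ≤ σ) (hkt : k * (t ^ 2 - 1) ≤ σ) (hσR : σ ≤ 1 - 2 / (3 * R)) (hx0 : 0 ≤ x) (hxa : 4 * x ≤ 3 * σ)
    (hq0 : 0 < q) (hq : 1 ≤ q ^ 2 * (1 + σ)) (hCin : 2 * x * (1 - 1 / k) * R * q ≤ R - 1) (hq'0 : 0 < q') (hq' : 1 ≤ q' ^ 2 * (1 + σ))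
    (hRlo : Rlo ≤ R) (hRhi : R ≤ Rhi) (hS : 1 - 2 / (3 * Rhi) ≤ S) (hsh0 : 0 < sh) (hsh : 1 + S ≤ sh ^ 2)
    (hX : 3 / 4 * S ≤ X ∨ 3 / 4 * sh * (1 - 1 / Rhi) ≤ X) (hX1 : X < 1)
    (hT2 : 1 + S / 3 ≤ T2 ∨ Rhi ≤ T2 ∨ 4 / 3 ≤ T2) (hT0 : 0 ≤ T) (hT : T2 ≤ T ^ 2)
    (hl2m : 4 / 3 ≤ l2m ∨ Rhi ≤ l2m ∨ 1 + S / 2 ≤ l2m) (hlh0 : 0 ≤ lh) (hlh : l2m ≤ lh ^ 2) (hL : lh * l2m ≤ L) (hacr : acr * sh ≤ 3) (hacr0 : 0 ≤ acr)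
    (h1 : 0 ≤ (3 * Rlo + acr) - (L + 1 / (1 - X / 3) + S / (2 * (1 - X)) + 1) - 3 / 2 * S / (1 - X))
    (hT' : 0 ≤ (3 * Rlo + acr) * T - (L + 1 / (1 - X / 3) + S / (2 * (1 - X)) + 1) * T ^ 2 - 3 / 2 * S / (1 - X)) :
    0 ≤ 3 * R * t ^ 2 + 3 * l ^ 2 * q' * t ^ 2 - l ^ 3 * t ^ 3 - t ^ 3 / (1 - x / k) - k * (t ^ 2 - 1) * (3 * t + t ^ 3) / (2 * (1 - x)) - t ^ 3 := by
  have hRpos : 0 < R := by linarith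
  have hRhi0 : 0 < Rhi := by linarith
  have hσS : σ ≤ S := by
    have : 2 / (3 * Rhi) ≤ 2 / (3 * R) := div_le_div_of_nonneg_left (by norm_num) (by positivity) (by linarith)
    linarith
  have ht0 : 0 ≤ t := by linarith
  have hl0 : 0 ≤ l := by linarith
  have htl2 : t ^ 2 ≤ l ^ 2 := pow_le_pow_left₀ ht0 htl 2
  have hE1a : t ^ 2 ≤ 1 + S / 3 := by
    have h0 : 0 ≤ t ^ 2 - 1 := by nlinarith
    have : 3 * (t ^ 2 - 1) ≤ k * (t ^ 2 - 1) := mul_le_mul_of_nonneg_right hk h0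
    linarith
  have hE1b : t ^ 2 ≤ Rhi := by linarith
  have hE1c : t ^ 2 ≤ 4 / 3 := htl2.trans hly
  have htT2 : t ^ 2 ≤ T2 := by rcases hT2 with h | h | h <;> linarith
  have htT : t ≤ T := (pow_le_pow_iff_left₀ ht0 hT0 two_ne_zero).mp (htT2.trans hT)
  have hE2c : l ^ 2 ≤ 1 + S / 2 := by
    have h0 : 0 ≤ l ^ 2 - 1 := by nlinarith
    have : 2 * (l ^ 2 - 1) ≤ (k - 1) * (l ^ 2 - 1) := mul_le_mul_of_nonneg_right (by linarith) h0
    linarith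
  have hl2 : l ^ 2 ≤ l2m := by rcases hl2m with h | h | h <;> linarith
  have hllh : l ≤ lh := (pow_le_pow_iff_left₀ hl0 hlh0 two_ne_zero).mp (hl2.trans hlh)
  have hlL : l ^ 3 ≤ L :=
    calc l ^ 3 = l * l ^ 2 := by ring
      _ ≤ lh * l2m := mul_le_mul hllh hl2 (by positivity) hlh0
      _ ≤ L := hL
  have hxX : x ≤ X := by
    rcases hX with h | h
    · linarith
    · exact le_trans (cap_of_inner hk hR1 hRhi hx0 hq0 hq hσS hsh0 hsh hCin) h
  -- the extra credit coefficient: `3 l² q' ≥ 3 q' ≥ 3/sh ≥ acr`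
  have hqs : 1 ≤ q' * sh := by
    have h2 : (1:ℝ) ^ 2 ≤ (q' * sh) ^ 2 := by
      rw [one_pow, mul_pow]
      calc (1:ℝ) ≤ q' ^ 2 * (1 + σ) := hq'
        _ ≤ q' ^ 2 * sh ^ 2 := mul_le_mul_of_nonneg_left (by linarith) (sq_nonneg q')
    exact (pow_le_pow_iff_left₀ zero_le_one (mul_pos hq'0 hsh0).le two_ne_zero).mp h2
  have hAcr : acr ≤ 3 * l ^ 2 * q' := by
    have h3 : acr ≤ 3 * q' := by
      have := mul_le_mul_of_nonneg_left hqs hacr0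
      have := mul_le_mul_of_nonneg_right hacr hq'0.le
      nlinarith only [this, hacr0, hq'0, hqs, hacr]
    have hl2 : 1 ≤ l ^ 2 := by nlinarith only [hl1]
    have : 3 * q' ≤ 3 * l ^ 2 * q' := by
      have := mul_le_mul_of_nonneg_right hl2 (by linarith only [hq'0] : 0 ≤ 3 * q'); linarith only [this]
    linarith only [h3, this]
  have := old_core (κ := 3) (Acr := 3 * l ^ 2 * q') (Dc := 1) (by norm_num) hk hRlo ht1 htT hl0 hlL hx0 hxX (by linarith) hX1 hkt hσS
    hAcr zero_le_one h1 hT'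
  linarith [this]

/-- **THE OLD CHAIN OF THE MERGED FIRST SLOT, `k ≥ 3`.**  In the census letters of the slot of `p = m+2` (depth `≥ 2`: `l² ≤ 4∕3`, `σ ≤ 1 − 2∕(3R)`), with
`q' = h_{p+2k−1}∕h_{p+k+1}` (`q'²(1+σ) ≥ 1`: the old read of the old decay step within the tangent factor of the slot's old read) and the relations of
(E85a) `old_slot_cert`:  `3Rt² + 3l²q't² − l³t³ − t³∕(1−x∕k) − k(t²−1)(3t+t³)∕(2(1−x)) − t³ ≥ 0` — per unit `c_{p+1}`: the slot's old credit and the old part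
`3c_{m+k+1}ρ'` of the old decay step's credit pay `c_{m+1}`, the lag-zero and defect∕tail parts and the extra window damping `c_{m+2}`. [folklore] -/
theorem merged_old_cert {R t l x k σ q q' : ℝ}
    (hk : 3 ≤ k) (hR1 : 1 ≤ R) (ht1 : 1 ≤ t) (hl1 : 1 ≤ l) (htl : t ≤ l) (hly : l ^ 2 ≤ 4 / 3) (hlR : l ^ 2 ≤ R)
    (hlσ : (k - 1) * (l ^ 2 - 1) ≤ σ) (hkt : k * (t ^ 2 - 1) ≤ σ) (hσR : σ ≤ 1 - 2 / (3 * R)) (hx0 : 0 ≤ x) (hxa : 4 * x ≤ 3 * σ)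
    (hq0 : 0 < q) (hq : 1 ≤ q ^ 2 * (1 + σ)) (hCin : 2 * x * (1 - 1 / k) * R * q ≤ R - 1) (hq'0 : 0 < q') (hq' : 1 ≤ q' ^ 2 * (1 + σ)) :
    0 ≤ 3 * R * t ^ 2 + 3 * l ^ 2 * q' * t ^ 2 - l ^ 3 * t ^ 3 - t ^ 3 / (1 - x / k) - k * (t ^ 2 - 1) * (3 * t + t ^ 3) / (2 * (1 - x)) - t ^ 3 := by
  by_cases hc0 : R ≤ 743 / 500
  · exact merged_old_case hk hR1 ht1 hl1 htl hly hlR hlσ hkt hσR hx0 hxa hq0 hq hCin hq'0 hq' hR1 hc0 (S := 1229 / 2229) (sh := 623 / 500) (X := 454167 / 1486000) (T2 := 7916 / 6687) (T := 1089 / 1000) (l2m := 5687 / 4458) (lh := 113 / 100) (L := 721 / 500) (acr := 1500 / 623) (by norm_num) (by norm_num) (by norm_num) (Or.inr (by norm_num)) (by norm_num) (Or.inl (by norm_num)) (by norm_num) (by norm_num) (Or.inr (Or.inr (by norm_num))) (by norm_num) (by norm_num) (by norm_num) (by norm_num) (by norm_num) (by norm_num) (by norm_num)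
  by_cases hc1 : R ≤ 52 / 25
  · exact merged_old_case hk hR1 ht1 hl1 htl hly hlR hlσ hkt hσR hx0 hxa hq0 hq hCin hq'0 hq' (not_le.mp hc0).le hc1 (S := 53 / 78) (sh := 162 / 125) (X := 6561 / 13000) (T2 := 287 / 234) (T := 277 / 250) (l2m := 4 / 3) (lh := 231 / 200) (L := 77 / 50) (acr := 125 / 54) (by norm_num) (by norm_num) (by norm_num) (Or.inr (by norm_num)) (by norm_num) (Or.inl (by norm_num)) (by norm_num) (by norm_num) (Or.inl (by norm_num)) (by norm_num) (by norm_num) (by norm_num) (by norm_num) (by norm_num) (by norm_num) (by norm_num)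
  by_cases hc2 : R ≤ 3907 / 1000
  · exact merged_old_case hk hR1 ht1 hl1 htl hly hlR hlσ hkt hσR hx0 hxa hq0 hq hCin hq'0 hq' (not_le.mp hc1).le hc2 (S := 9721 / 11721) (sh := 1353 / 1000) (X := 9721 / 15628) (T2 := 44884 / 35163) (T := 113 / 100) (l2m := 4 / 3) (lh := 231 / 200) (L := 77 / 50) (acr := 1000 / 451) (by norm_num) (by norm_num) (by norm_num) (Or.inl (by norm_num)) (by norm_num) (Or.inl (by norm_num)) (by norm_num) (by norm_num) (Or.inl (by norm_num)) (by norm_num) (by norm_num) (by norm_num) (by norm_num) (by norm_num) (by norm_num) (by norm_num)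
  by_cases hc3 : R ≤ 6
  · exact merged_old_case hk hR1 ht1 hl1 htl hly hlR hlσ hkt hσR hx0 hxa hq0 hq hCin hq'0 hq' (not_le.mp hc2).le hc3 (S := 8 / 9) (sh := 11 / 8) (X := 2 / 3) (T2 := 35 / 27) (T := 1139 / 1000) (l2m := 4 / 3) (lh := 231 / 200) (L := 77 / 50) (acr := 24 / 11) (by norm_num) (by norm_num) (by norm_num) (Or.inl (by norm_num)) (by norm_num) (Or.inl (by norm_num)) (by norm_num) (by norm_num) (Or.inl (by norm_num)) (by norm_num) (by norm_num) (by norm_num) (by norm_num) (by norm_num) (by norm_num) (by norm_num)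
  exact merged_old_case hk hR1 ht1 hl1 htl hly hlR hlσ hkt hσR hx0 hxa hq0 hq hCin hq'0 hq' (not_le.mp hc3).le le_rfl (S := 1) (sh := 283 / 200) (X := 3 / 4) (T2 := 4 / 3) (T := 231 / 200) (l2m := 4 / 3) (lh := 231 / 200) (L := 77 / 50) (acr := 600 / 283) (by linarith [div_nonneg (by norm_num : (0:ℝ) ≤ 2) (by linarith : (0:ℝ) ≤ 3 * R)]) (by norm_num) (by norm_num) (Or.inl (by norm_num)) (by norm_num) (Or.inl (by norm_num)) (by norm_num) (by norm_num) (Or.inl (by norm_num)) (by norm_num) (by norm_num) (by norm_num) (by norm_num) (by norm_num) (by norm_num) (by norm_num)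

/-- **THE OLD CHAIN OF THE MERGED FIRST SLOT, `k = 2`.**  For `k = 2` the old decay step is the slot's own step (`R = l²`, double credit `6l²t²`):
under `t ≤ l`, `l² ≤ 4∕3`, `2(t²−1) ≤ σ ≤ 1 − 2∕(3l²)`, `4x ≤ 3σ`:  `6l²t² − l³t³ − t³∕(1−x∕2) − 2(t²−1)(3t+t³)∕(2(1−x)) − t³ ≥ 0` (one interval). [folklore] -/
theorem merged_old_two {l t x σ : ℝ} (ht1 : 1 ≤ t) (hl1 : 1 ≤ l) (htl : t ≤ l) (hly : l ^ 2 ≤ 4 / 3) (h2t : 2 * (t ^ 2 - 1) ≤ σ)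
    (hσR : σ ≤ 1 - 2 / (3 * l ^ 2)) (hx0 : 0 ≤ x) (hxa : 4 * x ≤ 3 * σ) :
    0 ≤ 6 * l ^ 2 * t ^ 2 - l ^ 3 * t ^ 3 - t ^ 3 / (1 - x / 2) - 2 * (t ^ 2 - 1) * (3 * t + t ^ 3) / (2 * (1 - x)) - t ^ 3 := by
  have hl0 : 0 ≤ l := by linarith
  have ht0 : 0 ≤ t := by linarith
  have hl2 : 1 ≤ l ^ 2 := by nlinarith
  have hσS : σ ≤ 1 / 2 := by
    have : 2 / (3 * (4 / 3 : ℝ)) ≤ 2 / (3 * l ^ 2) := div_le_div_of_nonneg_left (by norm_num) (by positivity) (by linarith)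
    linarith
  have htl2 : t ^ 2 ≤ l ^ 2 := pow_le_pow_left₀ ht0 htl 2
  have htT : t ≤ 1119 / 1000 := by
    have : t ^ 2 ≤ (1119 / 1000 : ℝ) ^ 2 := by linarith
    exact (pow_le_pow_iff_left₀ ht0 (by norm_num) two_ne_zero).mp this
  have hllh : l ≤ 1155 / 1000 := by
    have : l ^ 2 ≤ (1155 / 1000 : ℝ) ^ 2 := by linarith
    exact (pow_le_pow_iff_left₀ hl0 (by norm_num) two_ne_zero).mp this
  have hlL : l ^ 3 ≤ 77 / 50 :=
    calc l ^ 3 = l * l ^ 2 := by ring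
      _ ≤ 1155 / 1000 * (4 / 3) := mul_le_mul hllh hly (by positivity) (by norm_num)
      _ ≤ 77 / 50 := by norm_num
  have hxX : x ≤ 3 / 8 := by linarith
  have := old_core (κ := 2) (k := 2) (R := l ^ 2) (Rlo := 1) (Acr := 3 * l ^ 2) (acr := 3) (Dc := 1) (X := 3 / 8) (S := 1 / 2) (L := 77 / 50)
    (by norm_num) le_rfl hl2 ht1 htT hl0 hlL hx0 hxX (by norm_num) (by norm_num) h2t hσS (by linarith) zero_le_one (by norm_num) (by norm_num)
  linarith [this]

end Summit.QuantumFields.BalabanUV.Beta.EriceRemainderEnclosureHistoryAutonomyComparisonAgeCompositionDecayBoundaryOldCertificate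

end
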